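import Summits.AtomisticToContinuum.BoseEinsteinCondensation.Theorems.BECStoquasticCensoringCountViolationGap

/-!
# `CountViolationGap` (stmt-AtomisticToContinuum-14968) is not vacuous: finite-energy violating states exist

Companion of `BECStoquasticCensoringCountViolationGap.lean` (reductions and the compression-witness skeleton
`iInf_energy_windowVanishing_le`). The support item `BECStoquasticCensoring.CountViolationGap` bounds from below, by
`E₀(N, L) + c₀aρM²`, the energy of EVERY Dirichlet trial state vanishing on the cell-count window
`|N_Q − ρℓ³| ≤ M√(ρℓ³)` of an interior cell `Q = x₀ + [0,ℓ)³`. This file proves that, under exactly the item's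
hypotheses on `(ρ, K, N, x₀, M)` (small density, large `N`), that class contains states of FINITE energy, so the
inequality is a genuine quantitative assertion (and in particular `E₀(N, L) < ∞` there):

* `groundStateEnergy_lt_top_of_fit` — `n ≤ m³`, `m(1+R) ≤ ℓ` ⇒ `E₀^D(n, ℓ) < ∞` (Ruelle padding: `n` singletons in
  unit cells of pitch `1 + R`, `groundStateEnergy_le_sum_cells`, `groundStateEnergy_one_lt_top`);
* `exists_cube_beside_cell` — beside an interior cell of `Λ_L` (`L ≥ 12(1+R)`) there is room for a translate of
  the cube of side `L/3 − R`, inside `Λ_L`, at distance `> R` from the cell;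
* `exists_windowVanishing_energy_lt_top_core` / `exists_windowVanishing_energy_lt_top` — the compression witness
  with `n = ⌊ρℓ³ + M√(ρℓ³)⌋ + 1` particles inside `Q` (`n ≤ 2ρℓ³ + 1 ≤ N`, fits in unit cells of `Q` once
  `216ρ(1+R)³ < 1`, which with `M² ≤ ρℓ³` forces `ℓ > 6(1+R)`) and `N − n` in the cube beside it has sharp count
  `N_Q = n` outside the window and finite energy (`iInf_energy_windowVanishing_le`).

No asymptotics: the energy of this witness exceeds `E₀(N, L)` by boundary terms of order `ρℓ²/ξ ≫ aρM²`, so it says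
nothing about the truth of the item (physically true with `c₀ → 4π`, see the assessment attached to the item).

References: D. Ruelle, *Statistical Mechanics: Rigorous Results* (1969), §3.5.11 (padding/merging of Dirichlet
states); LSSY2005 Ch. 2.
-/

noncomputable section

open Filter MeasureTheory
open scoped ENNReal

namespace Summit.AtomisticToContinuum.BoseEinsteinCondensation.Theorems

open Literature.MathematicalPhysics.QuantumManyBody.BoseGas

section NonVacuity

variable {v : ℝ → ℝ≥0∞} {R : ℝ}

/-- **Fitting lemma.** If `n ≤ m³` and `m (1 + R) ≤ ℓ` then `E₀^D(n, ℓ) < ∞`: `n` singletons in unit cells of an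
`m × m × m` grid of pitch `1 + R` (Ruelle padding, `groundStateEnergy_le_sum_cells`), each of finite energy
(`groundStateEnergy_one_lt_top`). [folklore] -/
theorem groundStateEnergy_lt_top_of_fit (hvm : Measurable v) (hv0 : ∀ r, R < r → v r = 0) (hR : 0 ≤ R)
    {n m : ℕ} (hnm : n ≤ m ^ 3) {ℓ : ℝ} (hmℓ : (m : ℝ) * (1 + R) ≤ ℓ) :
    groundStateEnergy v n ℓ < ⊤ := by
  let T : Finset (Fin (m ^ 3)) := Finset.univ.map (Fin.castLEEmb hnm)
  have hT : (∑ c ∈ T, (fun _ : Fin (m ^ 3) => (1 : ℕ)) c) = n := by simp [T]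
  have hcells := groundStateEnergy_le_sum_cells (v := v) hvm hv0 hR one_pos hmℓ T fun _ => 1
  calc groundStateEnergy v n ℓ
      = groundStateEnergy v (∑ c ∈ T, (fun _ : Fin (m ^ 3) => (1 : ℕ)) c) ℓ := by rw [hT]
    _ ≤ ∑ c ∈ T, groundStateEnergy v ((fun _ : Fin (m ^ 3) => (1 : ℕ)) c) 1 := hcells
    _ < ⊤ := ENNReal.sum_lt_top.2 fun _ _ => groundStateEnergy_one_lt_top v one_pos

/-- **Counting lemma.** If `(n : ℝ) < t³` with `t ≤ m` (`m` a natural number) then `n ≤ m³`. [folklore] -/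
theorem le_cube_of_lt {n m : ℕ} {t : ℝ} (ht : 0 ≤ t) (htm : t ≤ m) (hn : (n : ℝ) < t ^ 3) : n ≤ m ^ 3 := by
  have h : (n : ℝ) < (m : ℝ) ^ 3 := hn.trans_le (by gcongr)
  have h' : (n : ℝ) < ((m ^ 3 : ℕ) : ℝ) := by push_cast; exact h
  exact_mod_cast h'.le

/-- **Room beside an interior cell.** For an interior cell `Q = x₀ + [0, ℓ)³` of `Λ_L` (`ℓ ≤ x₀ₖ`, `x₀ₖ + 2ℓ ≤ L`,
`ℓ > 0`) and `0 < R` with `12 (1 + R) ≤ L`, there is a translate `U₂` of the open cube of side `L/3 − R` inside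
`Λ_L`, disjoint from `Q` and at distance `> R` from `Q` (placed beside `Q` along the first axis, on the roomier
side). [folklore] -/
theorem exists_cube_beside_cell {R ℓ L : ℝ} (hR : 0 < R) (hℓ : 0 < ℓ) (hL : 12 * (1 + R) ≤ L) (x₀ : Space)
    (hx₀ : ∀ k, ℓ ≤ x₀ k ∧ x₀ k + 2 * ℓ ≤ L) :
    ∃ a₂ : Space, {x : Space | x - a₂ ∈ box (L / 3 - R)} ⊆ box L ∧
      Disjoint {x : Space | x - a₂ ∈ box (L / 3 - R)} {x : Space | ∀ k, x k ∈ Set.Ico (x₀ k) (x₀ k + ℓ)} ∧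
      ∀ x ∈ {x : Space | ∀ k, x k ∈ Set.Ico (x₀ k) (x₀ k + ℓ)}, ∀ y ∈ {x : Space | x - a₂ ∈ box (L / 3 - R)},
        R < dist x y := by
  have h0 := hx₀ 0
  have hℓL : 3 * ℓ ≤ L := by linarith [h0.1, h0.2]
  have hL0 : 0 < L := by linarith
  rcases le_or_gt (2 * x₀ 0 + ℓ) L with hcase | hcase
  · -- room on the right of `Q` along axis 0
    refine ⟨PiLp.single 2 (0 : Fin 3) (x₀ 0 + ℓ + R), ?_, ?_, ?_⟩
    · intro x hx k
      have hk := hx k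
      simp only [PiLp.sub_apply, PiLp.single_apply, Set.mem_Ioo] at hk
      by_cases hk0 : k = 0
      · subst hk0
        simp only [if_true] at hk
        constructor <;> linarith [hk.1, hk.2]
      · simp only [hk0, if_false] at hk
        constructor <;> linarith [hk.1, hk.2]
    · refine Set.disjoint_left.2 fun x hx hxQ => ?_
      have hk := hx 0
      simp only [PiLp.sub_apply, PiLp.single_apply, if_true, Set.mem_Ioo] at hk
      have hq := (hxQ 0).2
      linarith [hk.1]
    · intro x hxQ y hy
      have hk := hy 0
      simp only [PiLp.sub_apply, PiLp.single_apply, if_true, Set.mem_Ioo] at hk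
      have hq := (hxQ 0).2
      have h1 : R < dist (x 0) (y 0) := by
        rw [Real.dist_eq, abs_sub_comm, abs_of_pos (by linarith [hk.1])]
        linarith [hk.1]
      exact h1.trans_le (PiLp.dist_apply_le x y 0)
  · -- room on the left of `Q` along axis 0
    refine ⟨PiLp.single 2 (0 : Fin 3) (x₀ 0 - R - (L / 3 - R)), ?_, ?_, ?_⟩
    · intro x hx k
      have hk := hx k
      simp only [PiLp.sub_apply, PiLp.single_apply, Set.mem_Ioo] at hk
      by_cases hk0 : k = 0
      · subst hk0
        simp only [if_true] at hk
        constructor <;> linarith [hk.1, hk.2]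
      · simp only [hk0, if_false] at hk
        constructor <;> linarith [hk.1, hk.2]
    · refine Set.disjoint_left.2 fun x hx hxQ => ?_
      have hk := hx 0
      simp only [PiLp.sub_apply, PiLp.single_apply, if_true, Set.mem_Ioo] at hk
      have hq := (hxQ 0).1
      linarith [hk.2]
    · intro x hxQ y hy
      have hk := hy 0
      simp only [PiLp.sub_apply, PiLp.single_apply, if_true, Set.mem_Ioo] at hk
      have hq := (hxQ 0).1
      have h1 : R < dist (x 0) (y 0) := by
        rw [Real.dist_eq, abs_of_pos (by linarith [hk.2])]
        linarith [hk.2]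
      exact h1.trans_le (PiLp.dist_apply_le x y 0)

/-- **Non-vacuity, core form.** For a measurable `v ≥ 0` of range `≤ R` (`R > 0`), a density with
`216 ρ (1+R)³ < 1`, a box `Λ_L` with `L³ = N/ρ`, `L ≥ 12(1+R)`, `N ≥ 2`, an interior cell `Q = x₀ + [0,ℓ)³`
(`ℓ ≤ x₀ₖ`, `x₀ₖ + 2ℓ ≤ L`) and a window parameter `1 ≤ M`, `M² ≤ ρℓ³`: there is a Dirichlet trial state of `N`
bosons in `Λ_L` vanishing on the window `|N_Q − ρℓ³| ≤ M√(ρℓ³)` and of FINITE energy — the compression witness with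
`n = ⌊ρℓ³ + M√(ρℓ³)⌋ + 1` particles in unit cells inside `Q` and `N − n` in unit cells of a cube beside `Q`. So the
universal quantifier over `Φ` in `CountViolationGap` ranges over a class containing finite-energy states: the item
is a genuine quantitative assertion, not vacuous. [folklore] -/
theorem exists_windowVanishing_energy_lt_top_core (hvm : Measurable v) (hR : 0 < R)
    (hv0 : ∀ r, R < r → v r = 0) {ρ ℓ L M : ℝ} {N : ℕ} (hρ : 0 < ρ)
    (hρR : ρ * (216 * (1 + R) ^ 3) < 1) (hL : 12 * (1 + R) ≤ L) (hN : 2 ≤ N)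
    (hLN : L ^ 3 = N / ρ) (x₀ : Space) (hx₀ : ∀ k, ℓ ≤ x₀ k ∧ x₀ k + 2 * ℓ ≤ L) (hM : 1 ≤ M)
    (hM2 : M ^ 2 ≤ ρ * ℓ ^ 3) :
    ∃ Φ : TrialState N L,
      (∀ X : Config N, |(∑ j : Fin N, ({x : Space | ∀ k, x k ∈ Set.Ico (x₀ k) (x₀ k + ℓ)}).indicator
          (fun _ => (1 : ℝ)) (X j)) - ρ * ℓ ^ 3| ≤ M * Real.sqrt (ρ * ℓ ^ 3) → Φ.ψ X = 0) ∧
      energy v Φ < ⊤ := by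
  set p : ℝ := 1 + R with hp
  have hp0 : 0 < p := by linarith
  set S : ℝ := ρ * ℓ ^ 3 with hS
  have hS1 : 1 ≤ S := le_trans (by nlinarith) hM2
  have hS0 : 0 < S := by linarith
  -- `ℓ > 0`, indeed `ℓ > 6p`
  have hℓ : 0 < ℓ := by
    by_contra h
    push Not at h
    have h2 : 0 ≤ ρ * ℓ ^ 2 := mul_nonneg hρ.le (sq_nonneg ℓ)
    have : ρ * ℓ ^ 3 ≤ 0 := by nlinarith
    linarith
  have hℓ3 : 216 * p ^ 3 < ℓ ^ 3 := by
    have h1 : ρ * (216 * p ^ 3) < ρ * ℓ ^ 3 := lt_of_lt_of_le hρR hS1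
    exact lt_of_mul_lt_mul_left h1 hρ.le
  have hℓp : 6 * p < ℓ := by
    have h1 : (6 * p) ^ 3 < ℓ ^ 3 := by
      have : (6 * p) ^ 3 = 216 * p ^ 3 := by ring
      rw [this]; exact hℓ3
    exact lt_of_pow_lt_pow_left₀ 3 hℓ.le h1
  -- the box
  have h0 := hx₀ 0
  have hℓL : 3 * ℓ ≤ L := by linarith [h0.1, h0.2]
  have hL0 : 0 < L := by linarith
  have hSN : 27 * S ≤ N := by
    have h27 : (3 * ℓ) ^ 3 ≤ L ^ 3 := pow_le_pow_left₀ (by positivity) hℓL 3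
    calc 27 * S = ρ * (3 * ℓ) ^ 3 := by rw [hS]; ring
      _ ≤ ρ * L ^ 3 := by gcongr
      _ = N := by rw [hLN]; exact mul_div_cancel₀ _ hρ.ne'
  -- the prescribed count `n`, just above the window
  set n : ℕ := ⌊S + M * Real.sqrt S⌋₊ + 1 with hn
  have hMs : 0 ≤ M * Real.sqrt S := mul_nonneg (by linarith) (Real.sqrt_nonneg _)
  have hn_gt : S + M * Real.sqrt S < n := by
    rw [hn]; push_cast; exact Nat.lt_floor_add_one _
  have hMS : M * Real.sqrt S ≤ S := by
    have hMle : M ≤ Real.sqrt S := (Real.le_sqrt' (by linarith)).2 hM2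
    calc M * Real.sqrt S ≤ Real.sqrt S * Real.sqrt S := by gcongr
      _ = S := Real.mul_self_sqrt hS0.le
  have hn_le : (n : ℝ) ≤ 2 * S + 1 := by
    rw [hn]; push_cast
    have := Nat.floor_le (show 0 ≤ S + M * Real.sqrt S by linarith)
    linarith
  have hN2 : (2 : ℝ) ≤ N := by exact_mod_cast hN
  have hnN : n ≤ N := by
    have : (n : ℝ) ≤ N := by linarith
    exact_mod_cast this
  have hout : M * Real.sqrt (ρ * ℓ ^ 3) < |(n : ℝ) - ρ * ℓ ^ 3| := by
    rw [← hS, abs_of_pos (by linarith)]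
    linarith
  -- inner fit: `n ≤ m₁³` singletons in unit cells of `Λ_ℓ`
  set m₁ : ℕ := ⌊ℓ / p⌋₊ with hm₁
  have hm₁ℓ : (m₁ : ℝ) * (1 + R) ≤ ℓ := by
    have h1 : (m₁ : ℝ) ≤ ℓ / p := Nat.floor_le (div_nonneg hℓ.le hp0.le)
    calc (m₁ : ℝ) * (1 + R) = (m₁ : ℝ) * p := by rw [hp]
      _ ≤ ℓ / p * p := by gcongr
      _ = ℓ := div_mul_cancel₀ ℓ hp0.ne'
  have hnm₁ : n ≤ m₁ ^ 3 := by
    refine le_cube_of_lt (t := 5 * ℓ / (6 * p)) (by positivity) ?_ ?_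
    · have h1 : ℓ / p < m₁ + 1 := Nat.lt_floor_add_one _
      have h2 : 1 ≤ ℓ / (6 * p) := by rw [le_div_iff₀ (by positivity)]; linarith
      have e : 5 * ℓ / (6 * p) = ℓ / p - ℓ / (6 * p) := by field_simp; ring
      rw [e]; linarith
    · have h1 : S < ℓ ^ 3 / (216 * p ^ 3) := by
        rw [hS, lt_div_iff₀ (by positivity)]
        calc ρ * ℓ ^ 3 * (216 * p ^ 3) = ρ * (216 * p ^ 3) * ℓ ^ 3 := by ring
          _ < 1 * ℓ ^ 3 := by gcongr
          _ = ℓ ^ 3 := one_mul _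
      have h2 : 1 < ℓ ^ 3 / (216 * p ^ 3) := by rw [lt_div_iff₀ (by positivity)]; linarith
      have e : (5 * ℓ / (6 * p)) ^ 3 = 125 * (ℓ ^ 3 / (216 * p ^ 3)) := by field_simp; ring
      rw [e]; linarith
  -- outer fit: `N - n ≤ m₂³` singletons in unit cells of a cube of side `L/3 - R`
  have hL₂ : 0 < L / 3 - R := by linarith
  set m₂ : ℕ := ⌊(L / 3 - R) / p⌋₊ with hm₂
  have hm₂L : (m₂ : ℝ) * (1 + R) ≤ L / 3 - R := by
    have h1 : (m₂ : ℝ) ≤ (L / 3 - R) / p := Nat.floor_le (div_nonneg hL₂.le hp0.le)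
    calc (m₂ : ℝ) * (1 + R) = (m₂ : ℝ) * p := by rw [hp]
      _ ≤ (L / 3 - R) / p * p := by gcongr
      _ = L / 3 - R := div_mul_cancel₀ _ hp0.ne'
  have hNm₂ : N - n ≤ m₂ ^ 3 := by
    refine (Nat.sub_le N n).trans (le_cube_of_lt (t := L / (6 * p)) (by positivity) ?_ ?_)
    · have h1 : (L / 3 - R) / p < m₂ + 1 := Nat.lt_floor_add_one _
      have h2 : R / p ≤ 1 := by rw [div_le_one hp0, hp]; linarith
      have h3 : 2 ≤ L / (6 * p) := by rw [le_div_iff₀ (by positivity)]; linarith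
      have e : (L / 3 - R) / p = 2 * (L / (6 * p)) - R / p := by field_simp; ring
      rw [e] at h1
      linarith
    · have hN0 : (0 : ℝ) < N := by linarith
      have hq : (1 : ℝ) < 1 / (ρ * (216 * p ^ 3)) := by
        rw [lt_div_iff₀ (by positivity)]; linarith
      have e1 : (L / (6 * p)) ^ 3 = L ^ 3 / (216 * p ^ 3) := by field_simp; ring
      have e2 : (N : ℝ) / ρ / (216 * p ^ 3) = N * (1 / (ρ * (216 * p ^ 3))) := by
        field_simp
      rw [e1, hLN, e2]
      calc (N : ℝ) = N * 1 := (mul_one _).symm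
        _ < N * (1 / (ρ * (216 * p ^ 3))) := by gcongr
  -- the two regions
  obtain ⟨a₂, hU₂L, hU₂Q, hsepQ⟩ := exists_cube_beside_cell hR hℓ hL x₀ hx₀
  set Q : Set Space := {x : Space | ∀ k, x k ∈ Set.Ico (x₀ k) (x₀ k + ℓ)} with hQ
  set U₁ : Set Space := {x : Space | x - x₀ ∈ box ℓ} with hU₁
  set U₂ : Set Space := {x : Space | x - a₂ ∈ box (L / 3 - R)} with hU₂
  have hU₁Q : U₁ ⊆ Q := by
    intro x hx k
    have hk := hx k
    simp only [PiLp.sub_apply, Set.mem_Ioo] at hk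
    constructor <;> linarith [hk.1, hk.2]
  have hU₁L : U₁ ⊆ box L := by
    intro x hx k
    have hk := hx k
    have hxk := hx₀ k
    simp only [PiLp.sub_apply, Set.mem_Ioo] at hk
    constructor <;> linarith [hk.1, hk.2, hxk.1, hxk.2]
  have hsep : ∀ x ∈ U₁, ∀ y ∈ U₂, R < dist x y := fun x hx y hy => hsepQ x (hU₁Q hx) y hy
  -- finiteness of the two blocks
  have h1 : infEnergy v n U₁ < ⊤ :=
    (infEnergy_translate_le v n (box ℓ) x₀).trans_lt (by
      rw [← groundStateEnergy_eq_infEnergy]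
      exact groundStateEnergy_lt_top_of_fit hvm hv0 hR.le hnm₁ hm₁ℓ)
  have h2 : infEnergy v (N - n) U₂ < ⊤ :=
    (infEnergy_translate_le v (N - n) (box (L / 3 - R)) a₂).trans_lt (by
      rw [← groundStateEnergy_eq_infEnergy]
      exact groundStateEnergy_lt_top_of_fit hvm hv0 hR.le hNm₂ hm₂L)
  have key := iInf_energy_windowVanishing_le (Q := Q) (U₁ := U₁) (U₂ := U₂) hnN hvm hv0 hR.le hsep
    hU₁Q hU₂Q hU₁L hU₂L hout
  have hlt := key.trans_lt (ENNReal.add_lt_top.2 ⟨h1, h2⟩)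
  rw [iInf_lt_iff] at hlt
  obtain ⟨Φ, hΦ⟩ := hlt
  rw [iInf_lt_iff] at hΦ
  obtain ⟨hwin, hE⟩ := hΦ
  exact ⟨Φ, hwin, hE⟩

/-- **Non-vacuity of `CountViolationGap` (item shape).** For every repulsive finite-range `v` there is `ρ₀ > 0`
such that for all `0 < ρ < ρ₀`, every `K`, all large `N`, every interior cell and every admissible `M` — i.e.
under exactly the hypotheses of the body of `BECStoquasticCensoring.CountViolationGap` — some Dirichlet trial
state vanishing on the count window has finite energy. Hence the item's inequality
`E₀(N, L) + c₀aρM² ≤ energy v Φ` is tested on finite-energy states (and `E₀(N, L) < ∞` there): the item is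
contentful. (For `a = 0` or `K ≤ 0` the `M`-range is empty and both the item and this lemma are vacuous.)
[folklore] -/
theorem exists_windowVanishing_energy_lt_top (v : ℝ → ℝ≥0∞) (hv : IsRepulsiveFiniteRange v) :
    ∃ ρ₀ : ℝ, 0 < ρ₀ ∧ ∀ ρ : ℝ, 0 < ρ → ρ < ρ₀ → ∀ K : ℝ, ∀ᶠ N : ℕ in Filter.atTop,
      let a : ℝ := (scatteringLength v).toReal
      let ℓ : ℝ := K * (ρ * a) ^ (-(1 / 2 : ℝ))
      let L : ℝ := sideLength ρ N
      ∀ x₀ : EuclideanSpace ℝ (Fin 3), (∀ k, ℓ ≤ x₀ k ∧ x₀ k + 2 * ℓ ≤ L) → ∀ M : ℝ, 1 ≤ M →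
        M ^ 2 ≤ ρ * ℓ ^ 3 → ∃ Φ : TrialState N L,
          (∀ X : Config N,
            |(∑ j : Fin N, ({x : EuclideanSpace ℝ (Fin 3) | ∀ k, x k ∈ Set.Ico (x₀ k) (x₀ k + ℓ)}).indicator
                (fun _ => (1 : ℝ)) (X j)) - ρ * ℓ ^ 3| ≤ M * Real.sqrt (ρ * ℓ ^ 3) → Φ.ψ X = 0) ∧
          energy v Φ < ⊤ := by
  obtain ⟨R, hR, hv0⟩ := hv.exists_pos_range
  refine ⟨1 / (216 * (1 + R) ^ 3), by positivity, fun ρ hρ hρR K => ?_⟩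
  have hρR' : ρ * (216 * (1 + R) ^ 3) < 1 := by
    rwa [lt_div_iff₀ (by positivity)] at hρR
  filter_upwards [(tendsto_sideLength_atTop hρ).eventually_ge_atTop (12 * (1 + R)),
    eventually_ge_atTop 2] with N hNL hN2
  intro a ℓ L x₀ hx₀ M hM hM2
  exact exists_windowVanishing_energy_lt_top_core hv.1 hR hv0 hρ hρR' hNL hN2 (sideLength_pow_three hρ N)
    x₀ hx₀ hM hM2

end NonVacuity

end Summit.AtomisticToContinuum.BoseEinsteinCondensation.Theorems

end
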